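import Summits.AtomisticToContinuum.Crystallization.Theorems.AveragedTwelve.Negative.LoadBearing

/-!
# `AveragedTwelve` (crux stmt-AtomisticToContinuum-15806), negative side III:
# the RADIUS-ONE (closed-star) local form is a genuine strengthening — and it is FALSE at 57/50

Write `deg j = #{k ∈ G, k ≠ j, dist (x j) (x k) ≤ ρ}` and `B i = {j ∈ G : dist (x i) (x j) ≤ ρ}` (the closed
ρ-star of `i`; it contains `i` when `ρ ≥ 0`).  The STAR form of the crux at ratio constant `c` says

  `∀ i ∈ G, Σ_{j ∈ B i} deg j ≤ 12·|B i|`      (every closed ρ-star averages at most twelve).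

* `averaged_of_star`: the star form IMPLIES the averaged crux (sum over `i`, swap the double sum using the
  symmetry of `dist`, `|B j| = deg j + 1`, then Cauchy–Schwarz: `S² ≤ n·Σ deg² ≤ n(11 S + 12 n)` forces
  `S ≤ 12 n`).  So it is a natural strengthening — it is exactly what a radius-one discharging / averaging
  rule would prove.
* `not_averagedTwelve_star`: the star form is FALSE at `c = 57/50`: an explicit 55-point integer
  configuration (a Z14 centre — bicapped staggered hexagonal antiprism, continued as a short rod — whose
  fourteen neighbours are all brought to ≥ 12 by free outer atoms; penalty optimisation, kit j022691) has a
  closed star of 15 sites with degrees 14,14,13,13,13,12×10, `Σ deg = 187 > 180 = 12·15` (kernel `decide`).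
* `not_averagedTwelve_weakCompensation`: even the weakest compensation statement — "a site with ≥ 13
  ρ-neighbours has SOME ρ-neighbour with ≤ 11" — is FALSE (same witness: all fourteen neighbours have ≥ 12).
CONSEQUENCE FOR PROVERS: no proof of `AveragedTwelve` can proceed by showing that each closed ρ-star
averages ≤ 12, and the route's planned layer-2 child "CompensationLemma" (radius-one compensation of
Z ≥ 13 sites by Σ(12 − Z)₊ over their own 1.14-neighbours) is false; the deficit that pays for an
over-coordinated site is NOT among its own ρ-neighbours (in the witness it sits on the free outer atoms,
two steps away).  This file does NOT refute the crux.  All `[folklore]`.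
-/

namespace Summit.AtomisticToContinuum.Crystallization.Theorems.AveragedTwelveNegative

open scoped BigOperators

/-! ## §1 The star form implies the averaged form -/

/-- STAR ⇒ AVERAGED.  If every closed `ρ`-star `B i = {j ∈ G : dist (x i) (x j) ≤ ρ}` satisfies
`Σ_{j ∈ B i} deg j ≤ 12·|B i|`, then `Σ_{i ∈ G} deg i ≤ 12·|G|` (any ratio constant `c`).  Proof: summing over
`i ∈ G` and swapping, `Σ_j deg j·|B j| ≤ 12 Σ_j |B j|` with `|B j| = deg j + 1` (`ρ ≥ 0`; for `ρ < 0` all degrees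
vanish), i.e. `Σ deg² ≤ 11 Σ deg + 12 n`, and Cauchy–Schwarz `(Σ deg)² ≤ n Σ deg²` gives
`(S − 12n)(S + n) ≤ 0`. [folklore] -/
theorem averaged_of_star (c : ℝ)
    (HS : ∀ (N : ℕ) (x : Fin N → EuclideanSpace ℝ (Fin 3)) (G : Finset (Fin N)) (d ρ : ℝ),
        0 < d → ρ ≤ c * d → (∀ i ∈ G, ∀ j ∈ G, i ≠ j → d ≤ dist (x i) (x j)) →
        ∀ i ∈ G, (∑ j ∈ G.filter (fun j => dist (x i) (x j) ≤ ρ),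
            ((G.filter fun k => k ≠ j ∧ dist (x j) (x k) ≤ ρ).card : ℝ))
          ≤ 12 * (G.filter (fun j => dist (x i) (x j) ≤ ρ)).card)
    (N : ℕ) (x : Fin N → EuclideanSpace ℝ (Fin 3)) (G : Finset (Fin N)) (d ρ : ℝ)
    (hd : 0 < d) (hρ : ρ ≤ c * d) (hsep : ∀ i ∈ G, ∀ j ∈ G, i ≠ j → d ≤ dist (x i) (x j)) :
    (∑ i ∈ G, ((G.filter fun j => j ≠ i ∧ dist (x i) (x j) ≤ ρ).card : ℝ)) ≤ 12 * G.card := by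
  classical
  by_cases hρ0 : 0 ≤ ρ
  · set deg : Fin N → ℝ := fun j => ((G.filter fun k => k ≠ j ∧ dist (x j) (x k) ≤ ρ).card : ℝ) with hdeg
    have hdeg0 : ∀ j, 0 ≤ deg j := fun j => by positivity
    -- |B j| = deg j + 1
    have hball : ∀ j ∈ G, ((G.filter (fun k => dist (x j) (x k) ≤ ρ)).card : ℝ) = deg j + 1 := by
      intro j hj
      have hB : G.filter (fun k => dist (x j) (x k) ≤ ρ)
          = insert j (G.filter fun k => k ≠ j ∧ dist (x j) (x k) ≤ ρ) := by
        ext k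
        simp only [Finset.mem_filter, Finset.mem_insert]
        constructor
        · rintro ⟨hk, hdk⟩
          by_cases hkj : k = j
          · exact Or.inl hkj
          · exact Or.inr ⟨hk, hkj, hdk⟩
        · rintro (rfl | ⟨hk, -, hdk⟩)
          · exact ⟨hj, by simpa using hρ0⟩
          · exact ⟨hk, hdk⟩
      have hnot : j ∉ (G.filter fun k => k ≠ j ∧ dist (x j) (x k) ≤ ρ) := by simp
      rw [hB, Finset.card_insert_of_notMem hnot]
      push_cast
      simp [hdeg]
    -- sum of the star inequalities over i ∈ G
    have hsum : ∑ i ∈ G, ∑ j ∈ G.filter (fun j => dist (x i) (x j) ≤ ρ), deg j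
        ≤ ∑ i ∈ G, 12 * ((G.filter (fun j => dist (x i) (x j) ≤ ρ)).card : ℝ) :=
      Finset.sum_le_sum (fun i hi => HS N x G d ρ hd hρ hsep i hi)
    -- swap the double sum
    have hswap : ∑ i ∈ G, ∑ j ∈ G.filter (fun j => dist (x i) (x j) ≤ ρ), deg j
        = ∑ j ∈ G, deg j * ((G.filter (fun k => dist (x j) (x k) ≤ ρ)).card : ℝ) := by
      calc ∑ i ∈ G, ∑ j ∈ G.filter (fun j => dist (x i) (x j) ≤ ρ), deg j
          = ∑ i ∈ G, ∑ j ∈ G, (if dist (x i) (x j) ≤ ρ then deg j else 0) := by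
              refine Finset.sum_congr rfl (fun i _ => ?_)
              rw [Finset.sum_filter]
        _ = ∑ j ∈ G, ∑ i ∈ G, (if dist (x i) (x j) ≤ ρ then deg j else 0) := Finset.sum_comm
        _ = ∑ j ∈ G, deg j * ((G.filter (fun k => dist (x j) (x k) ≤ ρ)).card : ℝ) := by
              refine Finset.sum_congr rfl (fun j _ => ?_)
              rw [← Finset.sum_filter]
              have hBj : (G.filter fun i => dist (x i) (x j) ≤ ρ) = G.filter (fun k => dist (x j) (x k) ≤ ρ) := by
                ext i
                simp only [Finset.mem_filter, dist_comm]
              rw [hBj, Finset.sum_const, nsmul_eq_mul, mul_comm]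
    -- Σ deg (deg + 1) ≤ 12 Σ (deg + 1)
    have hkey : ∑ j ∈ G, deg j ^ 2 ≤ 11 * ∑ j ∈ G, deg j + 12 * G.card := by
      have h1 : ∑ j ∈ G, deg j * ((G.filter (fun k => dist (x j) (x k) ≤ ρ)).card : ℝ)
          = ∑ j ∈ G, deg j ^ 2 + ∑ j ∈ G, deg j := by
        rw [← Finset.sum_add_distrib]
        refine Finset.sum_congr rfl (fun j hj => ?_)
        rw [hball j hj]; ring
      have h2 : ∑ i ∈ G, 12 * ((G.filter (fun j => dist (x i) (x j) ≤ ρ)).card : ℝ)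
          = 12 * ∑ j ∈ G, deg j + 12 * G.card := by
        rw [← Finset.mul_sum]
        have : ∑ i ∈ G, ((G.filter (fun j => dist (x i) (x j) ≤ ρ)).card : ℝ) = ∑ j ∈ G, deg j + G.card := by
          rw [Finset.sum_congr rfl (fun i hi => hball i hi), Finset.sum_add_distrib]
          simp
        rw [this]; ring
      have h3 := hsum
      rw [hswap, h1, h2] at h3
      linarith
    -- Cauchy–Schwarz and the quadratic inequality
    have hCS : (∑ j ∈ G, deg j) ^ 2 ≤ G.card * ∑ j ∈ G, deg j ^ 2 := sq_sum_le_card_mul_sum_sq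
    have hS0 : 0 ≤ ∑ j ∈ G, deg j := Finset.sum_nonneg (fun j _ => hdeg0 j)
    have hn0 : (0 : ℝ) ≤ G.card := by positivity
    have h3 : (∑ j ∈ G, deg j) ^ 2 ≤ G.card * (11 * ∑ j ∈ G, deg j + 12 * G.card) :=
      hCS.trans (mul_le_mul_of_nonneg_left hkey hn0)
    by_contra hlt
    push Not at hlt
    have h4 : 0 < (∑ j ∈ G, deg j) - 12 * G.card := sub_pos.mpr hlt
    have h5 : 0 < (∑ j ∈ G, deg j) + G.card := by linarith
    nlinarith [mul_pos h4 h5]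
  · -- ρ < 0: every degree vanishes
    push Not at hρ0
    have hzero : ∀ i ∈ G, ((G.filter fun j => j ≠ i ∧ dist (x i) (x j) ≤ ρ).card : ℝ) = 0 := by
      intro i _
      rw [Nat.cast_eq_zero, Finset.card_eq_zero, Finset.filter_eq_empty_iff]
      intro j _ h
      exact absurd (h.2.trans_lt hρ0) (not_lt.mpr dist_nonneg)
    rw [Finset.sum_congr rfl hzero]
    simp

/-! ## §2 Integer-coordinate reduction for the star form -/

/-- REFUTATION SHAPE for the star form.  An integer configuration `W` with pairwise squared distances
`≥ D > 0`, an integer radius `0 ≤ M ≤ c·√D`, and a site `i0` whose closed `M`-star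
`B = {j : |W i0 − W j|² ≤ M²}` satisfies `12·|B| < Σ_{j ∈ B} #{k ≠ j : |W j − W k|² ≤ M²}` refutes the star
form at ratio constant `c` (points `(W i 0, W i 1, W i 2) ∈ ℝ³`, `d = √D`, `ρ = M`, `G = univ`).  All
hypotheses except `hcM` are decidable integer facts. [folklore] -/
theorem not_star_of_intConfig (c : ℝ) {n : ℕ} (W : Fin n → Fin 3 → ℤ) (D M : ℤ)
    (hD : 0 < D) (hM : 0 ≤ M) (hcM : (M : ℝ) ≤ c * Real.sqrt D)
    (hsep : ∀ i j : Fin n, i ≠ j →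
      D ≤ (W i 0 - W j 0) ^ 2 + (W i 1 - W j 1) ^ 2 + (W i 2 - W j 2) ^ 2)
    (i0 : Fin n)
    (hcount : 12 * (Finset.univ.filter fun j : Fin n =>
        (W i0 0 - W j 0) ^ 2 + (W i0 1 - W j 1) ^ 2 + (W i0 2 - W j 2) ^ 2 ≤ M ^ 2).card
      < ∑ j ∈ Finset.univ.filter (fun j : Fin n =>
          (W i0 0 - W j 0) ^ 2 + (W i0 1 - W j 1) ^ 2 + (W i0 2 - W j 2) ^ 2 ≤ M ^ 2),
          (Finset.univ.filter fun k : Fin n => k ≠ j ∧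
            (W j 0 - W k 0) ^ 2 + (W j 1 - W k 1) ^ 2 + (W j 2 - W k 2) ^ 2 ≤ M ^ 2).card) :
    ¬ (∀ (N : ℕ) (x : Fin N → EuclideanSpace ℝ (Fin 3)) (G : Finset (Fin N)) (d ρ : ℝ),
        0 < d → ρ ≤ c * d → (∀ i ∈ G, ∀ j ∈ G, i ≠ j → d ≤ dist (x i) (x j)) →
        ∀ i ∈ G, (∑ j ∈ G.filter (fun j => dist (x i) (x j) ≤ ρ),
            ((G.filter fun k => k ≠ j ∧ dist (x j) (x k) ≤ ρ).card : ℝ))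
          ≤ 12 * (G.filter (fun j => dist (x i) (x j) ≤ ρ)).card) := by
  intro H
  -- the real configuration
  set X : Fin n → EuclideanSpace ℝ (Fin 3) :=
    fun k => (WithLp.toLp 2 ![((W k 0 : ℤ) : ℝ), ((W k 1 : ℤ) : ℝ), ((W k 2 : ℤ) : ℝ)] : EuclideanSpace ℝ (Fin 3))
    with hX
  have hsep' : ∀ i ∈ (Finset.univ : Finset (Fin n)), ∀ j ∈ (Finset.univ : Finset (Fin n)), i ≠ j →
      Real.sqrt D ≤ dist (X i) (X j) :=
    fun i _ j _ hij => (sqrt_le_dist_intPt_iff (W i) (W j) D).mpr (hsep i j hij)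
  have h := H n X Finset.univ (Real.sqrt D) M (Real.sqrt_pos.mpr (by exact_mod_cast hD)) hcM hsep'
    i0 (Finset.mem_univ _)
  -- translate every filter to integer arithmetic
  have hdistM : ∀ i j : Fin n, dist (X i) (X j) ≤ (M : ℝ) ↔
      (W i 0 - W j 0) ^ 2 + (W i 1 - W j 1) ^ 2 + (W i 2 - W j 2) ^ 2 ≤ M ^ 2 :=
    fun i j => dist_intPt_le_iff (W i) (W j) M hM
  have hB : ((Finset.univ : Finset (Fin n)).filter fun j => dist (X i0) (X j) ≤ (M : ℝ))
      = (Finset.univ.filter fun j : Fin n =>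
          (W i0 0 - W j 0) ^ 2 + (W i0 1 - W j 1) ^ 2 + (W i0 2 - W j 2) ^ 2 ≤ M ^ 2) :=
    Finset.filter_congr (fun j _ => hdistM i0 j)
  have hdeg : ∀ j : Fin n, ((Finset.univ : Finset (Fin n)).filter fun k => k ≠ j ∧ dist (X j) (X k) ≤ (M : ℝ))
      = (Finset.univ.filter fun k : Fin n => k ≠ j ∧
          (W j 0 - W k 0) ^ 2 + (W j 1 - W k 1) ^ 2 + (W j 2 - W k 2) ^ 2 ≤ M ^ 2) :=
    fun j => Finset.filter_congr (fun k _ => by rw [hdistM j k])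
  simp_rw [hdeg] at h
  rw [hB] at h
  have hc : ((12 * (Finset.univ.filter fun j : Fin n =>
        (W i0 0 - W j 0) ^ 2 + (W i0 1 - W j 1) ^ 2 + (W i0 2 - W j 2) ^ 2 ≤ M ^ 2).card : ℕ) : ℝ)
      < ((∑ j ∈ Finset.univ.filter (fun j : Fin n =>
          (W i0 0 - W j 0) ^ 2 + (W i0 1 - W j 1) ^ 2 + (W i0 2 - W j 2) ^ 2 ≤ M ^ 2),
          (Finset.univ.filter fun k : Fin n => k ≠ j ∧
            (W j 0 - W k 0) ^ 2 + (W j 1 - W k 1) ^ 2 + (W j 2 - W k 2) ^ 2 ≤ M ^ 2).card : ℕ) : ℝ) := by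
    exact_mod_cast hcount
  push_cast at hc
  linarith

/-! ## §3 The weakest compensation statement and its integer reduction -/

/-- REFUTATION SHAPE for the WEAK COMPENSATION form ("a site with ≥ 13 ρ-neighbours has a ρ-neighbour with
≤ 11").  An integer configuration with pairwise squared distances `≥ D > 0`, `0 ≤ M ≤ c·√D`, a site `i0` with
`≥ 13` others within squared distance `M²`, all of which have `≥ 12` others within `M²`, refutes it. [folklore] -/
theorem not_weakCompensation_of_intConfig (c : ℝ) {n : ℕ} (W : Fin n → Fin 3 → ℤ) (D M : ℤ)
    (hD : 0 < D) (hM : 0 ≤ M) (hcM : (M : ℝ) ≤ c * Real.sqrt D)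
    (hsep : ∀ i j : Fin n, i ≠ j →
      D ≤ (W i 0 - W j 0) ^ 2 + (W i 1 - W j 1) ^ 2 + (W i 2 - W j 2) ^ 2)
    (i0 : Fin n)
    (hcentre : 13 ≤ (Finset.univ.filter fun j : Fin n => j ≠ i0 ∧
        (W i0 0 - W j 0) ^ 2 + (W i0 1 - W j 1) ^ 2 + (W i0 2 - W j 2) ^ 2 ≤ M ^ 2).card)
    (hnbrs : ∀ j : Fin n, j ≠ i0 →
        (W i0 0 - W j 0) ^ 2 + (W i0 1 - W j 1) ^ 2 + (W i0 2 - W j 2) ^ 2 ≤ M ^ 2 →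
        12 ≤ (Finset.univ.filter fun k : Fin n => k ≠ j ∧
          (W j 0 - W k 0) ^ 2 + (W j 1 - W k 1) ^ 2 + (W j 2 - W k 2) ^ 2 ≤ M ^ 2).card) :
    ¬ (∀ (N : ℕ) (x : Fin N → EuclideanSpace ℝ (Fin 3)) (G : Finset (Fin N)) (d ρ : ℝ),
        0 < d → ρ ≤ c * d → (∀ i ∈ G, ∀ j ∈ G, i ≠ j → d ≤ dist (x i) (x j)) →
        ∀ i ∈ G, 13 ≤ (G.filter fun j => j ≠ i ∧ dist (x i) (x j) ≤ ρ).card →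
          ∃ j ∈ G, j ≠ i ∧ dist (x i) (x j) ≤ ρ ∧ (G.filter fun k => k ≠ j ∧ dist (x j) (x k) ≤ ρ).card ≤ 11) := by
  intro H
  set X : Fin n → EuclideanSpace ℝ (Fin 3) :=
    fun k => (WithLp.toLp 2 ![((W k 0 : ℤ) : ℝ), ((W k 1 : ℤ) : ℝ), ((W k 2 : ℤ) : ℝ)] : EuclideanSpace ℝ (Fin 3))
    with hX
  have hsep' : ∀ i ∈ (Finset.univ : Finset (Fin n)), ∀ j ∈ (Finset.univ : Finset (Fin n)), i ≠ j →
      Real.sqrt D ≤ dist (X i) (X j) :=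
    fun i _ j _ hij => (sqrt_le_dist_intPt_iff (W i) (W j) D).mpr (hsep i j hij)
  have hdistM : ∀ i j : Fin n, dist (X i) (X j) ≤ (M : ℝ) ↔
      (W i 0 - W j 0) ^ 2 + (W i 1 - W j 1) ^ 2 + (W i 2 - W j 2) ^ 2 ≤ M ^ 2 :=
    fun i j => dist_intPt_le_iff (W i) (W j) M hM
  have hdeg : ∀ j : Fin n, ((Finset.univ : Finset (Fin n)).filter fun k => k ≠ j ∧ dist (X j) (X k) ≤ (M : ℝ))
      = (Finset.univ.filter fun k : Fin n => k ≠ j ∧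
          (W j 0 - W k 0) ^ 2 + (W j 1 - W k 1) ^ 2 + (W j 2 - W k 2) ^ 2 ≤ M ^ 2) :=
    fun j => Finset.filter_congr (fun k _ => by rw [hdistM j k])
  have hc' : 13 ≤ ((Finset.univ : Finset (Fin n)).filter fun j => j ≠ i0 ∧ dist (X i0) (X j) ≤ (M : ℝ)).card := by
    rw [hdeg i0]; exact hcentre
  obtain ⟨j, -, hji, hdj, hle⟩ := H n X Finset.univ (Real.sqrt D) M (Real.sqrt_pos.mpr (by exact_mod_cast hD)) hcM hsep'
    i0 (Finset.mem_univ _) hc'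
  rw [hdeg j] at hle
  have h12 := hnbrs j hji ((hdistM i0 j).mp hdj)
  omega

/-! ## §4 The concrete witness (kit job j022691, cdisprove gen 2): radius-one compensation fails at 57/50 -/

set_option maxRecDepth 200000 in
/-- THE RADIUS-ONE LOCAL (STAR) FORM OF THE CRUX IS FALSE at ratio 57/50.  Witness (in the proof): 55 integer
points (scale K = 400 of a configuration with minimum distance 1): a Z14 centre `W 0` — bicapped staggered hexagonal
antiprism: poles `(0,0,±400)`, two staggered hexagonal rings of radius ≈ 1.0 at heights ≈ ±0.5 — continued as a short
rod (next rings, next axis sites) and decorated by free outer atoms at radii ≈ 1.8 (between ring atoms) and ≈ 1.95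
(outside each ring atom at the axis heights), found by penalty optimisation (kit j022691, seed family `z14`).
All pairs have squared distance ≥ 160004; with `M = 456` (`2500·M² ≤ 3249·160004`, i.e. `M ≤ (57/50)√D`) the closed star of the centre = 15 sites with degrees [14, 13, 14, 13, 12, 12, 12, 12, 12, 13, 12, 12, 12, 12, 12] (sum 187 > 180):
the closed `M`-star of the centre averages MORE than twelve although the configuration is `√D`-separated.
Hence no proof of `AveragedTwelve` can show that every closed ρ-star averages ≤ 12 (which WOULD imply the crux,
`averaged_of_star`). (kernel `decide` on the integer certificate.) [folklore] -/
theorem not_averagedTwelve_star :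
    ¬ (∀ (N : ℕ) (x : Fin N → EuclideanSpace ℝ (Fin 3)) (G : Finset (Fin N)) (d ρ : ℝ),
        0 < d → ρ ≤ 57 / 50 * d → (∀ i ∈ G, ∀ j ∈ G, i ≠ j → d ≤ dist (x i) (x j)) →
        ∀ i ∈ G, (∑ j ∈ G.filter (fun j => dist (x i) (x j) ≤ ρ),
            ((G.filter fun k => k ≠ j ∧ dist (x j) (x k) ≤ ρ).card : ℝ))
          ≤ 12 * (G.filter (fun j => dist (x i) (x j) ≤ ρ)).card) := by
  obtain ⟨W, hW⟩ : ∃ W : Fin 55 → Fin 3 → ℤ, W = ![![0, 0, 0], ![0, 2, 401], ![0, -2, -400], ![405, 0, 192], ![348, 198, -200], ![202, 347, 195], ![1, 400, -200], ![-200, 348, 196], ![-347, 201, -200], ![-405, 3, 193], ![-349, -201, -197], ![-202, -344, 200], ![-2, -403, -195], ![200, -346, 200], ![347, -203, -198], ![2, 13, 804], ![18, -29, -802], ![341, 199, 544], ![410, -5, -543], ![593, 385, 94], ![695, -4, -159], ![843, 88, 205], ![664, -43, 542], ![638, 372, -421], ![2, 418, 539], ![206, 350, -545], ![2, 688, 111],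 ![333, 615, -112], ![406, 678, 309], ![-10, 745, -411], ![-341, 204, 547], ![-204, 353, -545], ![-589, 389, 94], ![-328, 618, -111], ![-391, 689, 304], ![-634, 373, -425], ![-300, -210, 567], ![-409, -2, -543], ![-596, -345, 97], ![-695, 2, -157], ![-843, 95, 206], ![-663, -38, 543], ![-636, -366, -427], ![-2, -513, 506], ![-208, -361, -540], ![-3, -683, 104], ![-344, -594, -97], ![-395, -683, 311], ![4, -738, -421], ![299, -213, 568], ![205, -361, -540], ![593, -348, 97], ![339, -596, -97], ![391, -685, 309], ![634, -373, -425]] := ⟨_, rfl⟩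
  have hsep : ∀ i j : Fin 55, i ≠ j →
      (160004 : ℤ) ≤ (W i 0 - W j 0) ^ 2 + (W i 1 - W j 1) ^ 2 + (W i 2 - W j 2) ^ 2 := by
    subst hW; decide
  have hcount : 12 * (Finset.univ.filter fun j : Fin 55 =>
        (W 0 0 - W j 0) ^ 2 + (W 0 1 - W j 1) ^ 2 + (W 0 2 - W j 2) ^ 2 ≤ (456 : ℤ) ^ 2).card
      < ∑ j ∈ Finset.univ.filter (fun j : Fin 55 =>
          (W 0 0 - W j 0) ^ 2 + (W 0 1 - W j 1) ^ 2 + (W 0 2 - W j 2) ^ 2 ≤ (456 : ℤ) ^ 2),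
          (Finset.univ.filter fun k : Fin 55 => k ≠ j ∧
            (W j 0 - W k 0) ^ 2 + (W j 1 - W k 1) ^ 2 + (W j 2 - W k 2) ^ 2 ≤ (456 : ℤ) ^ 2).card := by
    subst hW; decide
  have hcM : ((456 : ℤ) : ℝ) ≤ 57 / 50 * Real.sqrt ((160004 : ℤ) : ℝ) := by
    have h1 : ((22800) / 57 : ℝ) ≤ Real.sqrt 160004 := (Real.le_sqrt' (by norm_num)).mpr (by norm_num)
    push_cast
    linarith
  exact not_star_of_intConfig (57 / 50) W 160004 456 (by norm_num) (by norm_num) hcM hsep 0 hcount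

set_option maxRecDepth 200000 in
/-- THE WEAK COMPENSATION FORM IS FALSE at ratio 57/50: in the same witness the centre has 14 ≥ 13 neighbours within
`ρ` and EVERY one of them has ≥ 12 neighbours within `ρ` — an over-coordinated site need not have any under-coordinated
ρ-neighbour.  In particular the route's proposed layer-2 child "CompensationLemma" (every `Z ≥ 13` site is paid for by
`Σ(12 − Z)₊` over its own 1.14-neighbours) is false as a statement about `d`-separated sets. (kernel `decide`.) [folklore] -/
theorem not_averagedTwelve_weakCompensation :
    ¬ (∀ (N : ℕ) (x : Fin N → EuclideanSpace ℝ (Fin 3)) (G : Finset (Fin N)) (d ρ : ℝ),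
        0 < d → ρ ≤ 57 / 50 * d → (∀ i ∈ G, ∀ j ∈ G, i ≠ j → d ≤ dist (x i) (x j)) →
        ∀ i ∈ G, 13 ≤ (G.filter fun j => j ≠ i ∧ dist (x i) (x j) ≤ ρ).card →
          ∃ j ∈ G, j ≠ i ∧ dist (x i) (x j) ≤ ρ ∧ (G.filter fun k => k ≠ j ∧ dist (x j) (x k) ≤ ρ).card ≤ 11) := by
  obtain ⟨W, hW⟩ : ∃ W : Fin 55 → Fin 3 → ℤ, W = ![![0, 0, 0], ![0, 2, 401], ![0, -2, -400], ![405, 0, 192], ![348, 198, -200], ![202, 347, 195], ![1, 400, -200], ![-200, 348, 196], ![-347, 201, -200], ![-405, 3, 193], ![-349, -201, -197], ![-202, -344, 200], ![-2, -403, -195], ![200, -346, 200], ![347, -203, -198], ![2, 13, 804], ![18, -29, -802], ![341, 199, 544], ![410, -5, -543], ![593, 385, 94], ![695, -4, -159], ![843, 88, 205], ![664, -43, 542], ![638, 372, -421], ![2, 418, 539], ![206, 350, -545], ![2, 688, 111], ![333, 615, -112], ![406, 678, 309], ![-10, 745, -411], ![-341, 204, 547], ![-204, 353, -545], ![-589,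 389, 94], ![-328, 618, -111], ![-391, 689, 304], ![-634, 373, -425], ![-300, -210, 567], ![-409, -2, -543], ![-596, -345, 97], ![-695, 2, -157], ![-843, 95, 206], ![-663, -38, 543], ![-636, -366, -427], ![-2, -513, 506], ![-208, -361, -540], ![-3, -683, 104], ![-344, -594, -97], ![-395, -683, 311], ![4, -738, -421], ![299, -213, 568], ![205, -361, -540], ![593, -348, 97], ![339, -596, -97], ![391, -685, 309], ![634, -373, -425]] := ⟨_, rfl⟩
  have hsep : ∀ i j : Fin 55, i ≠ j →
      (160004 : ℤ) ≤ (W i 0 - W j 0) ^ 2 + (W i 1 - W j 1) ^ 2 + (W i 2 - W j 2) ^ 2 := by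
    subst hW; decide
  have hcentre : 13 ≤ (Finset.univ.filter fun j : Fin 55 => j ≠ 0 ∧
      (W 0 0 - W j 0) ^ 2 + (W 0 1 - W j 1) ^ 2 + (W 0 2 - W j 2) ^ 2 ≤ (456 : ℤ) ^ 2).card := by
    subst hW; decide
  have hnbrs : ∀ j : Fin 55, j ≠ 0 →
      (W 0 0 - W j 0) ^ 2 + (W 0 1 - W j 1) ^ 2 + (W 0 2 - W j 2) ^ 2 ≤ (456 : ℤ) ^ 2 →
      12 ≤ (Finset.univ.filter fun k : Fin 55 => k ≠ j ∧
        (W j 0 - W k 0) ^ 2 + (W j 1 - W k 1) ^ 2 + (W j 2 - W k 2) ^ 2 ≤ (456 : ℤ) ^ 2).card := by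
    subst hW; decide
  have hcM : ((456 : ℤ) : ℝ) ≤ 57 / 50 * Real.sqrt ((160004 : ℤ) : ℝ) := by
    have h1 : ((22800) / 57 : ℝ) ≤ Real.sqrt 160004 := (Real.le_sqrt' (by norm_num)).mpr (by norm_num)
    push_cast
    linarith
  exact not_weakCompensation_of_intConfig (57 / 50) W 160004 456 (by norm_num) (by norm_num) hcM hsep 0 hcentre hnbrs

end Summit.AtomisticToContinuum.Crystallization.Theorems.AveragedTwelveNegative
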